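import Summits.SmoothPoincare4.SmoothPoincare4.Theorems.CongruenceShadowsNilpotentShadowsStandardTorsorCalculus
import HarnessLib

/-!
# The layer step from realised data (helper for stub `stub_nilpotentLayerStep`)

Line `nilpotent-genus-class`, crux `CongruenceShadows.ShadowApproximation` (item stmt-SmoothPoincare4-14595).
Pure group theory on top of the landed torsor calculus
(`CongruenceShadowsNilpotentShadowsStandardTorsorCalculus`: `level_mem_iff`, `level_data`,
`commutator_sup_lcs_top_le`).

Setting: a group `G`, `γₙ₊₁ = (⊤ : Subgroup G).lowerCentralSeries n`, a set of "cut letters" `S` with normal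
closure `P = ⟪S⟫` (the standard kernel `N₂`), a normal subgroup `Q` WITHOUT HIDDEN DEPTH (`Q ∩ γ₂ ≤ [Q,G]`; every
handlebody kernel, landed `stub_noHiddenDepth`) with the same level-`c` shadow, `Q γ_{c+2} = P γ_{c+2}` (the layer
step's hypothesis on `K₂`), and lifts `u x ∈ γ_{c+2}` with `u x · x ∈ Q` (`x ∈ S`) — the level-`(c+1)` DATUM of `Q`.

* `map_sup_lcs_eq_of_johnson` — an automorphism `y` with `y s · s⁻¹ ∈ γ_{c+2}` for all `s` (the `(c+1)`-st term
  of the Johnson–Andreadakis filtration) does not move `P γ_{c+2}`.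
* `map_sup_lcs_eq_of_data` — **THE LAYER STEP FROM REALISED DATA**: if moreover the Johnson datum of `y` agrees
  with the datum of `Q` on the cut letters modulo the torsor ambiguity,
  `y x · x⁻¹ · (u x)⁻¹ ∈ [P,G] γ_{c+3}` for `x ∈ S`, then `y(P γ_{c+3}) = Q γ_{c+3}`.
So the layer step at `(m,c)` is reduced to producing such a `y` inside the Goeritz group `Stab N₀ ∩ Stab N₁`
("Goeritz–Johnson realisation modulo `𝔠`", the worker's evidence files `evidence-layer10/01.md` on the item):
no second handlebody, no gate identity and no shadow hypothesis enter this implication.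
Everything is proved; no definitions, no named facts.
-/

set_option linter.dupNamespace false

open Subgroup
open scoped commutatorElement
open Summit.SmoothPoincare4.SmoothPoincare4.Theorems.NilpotentShadowsStandard.SaturatedTorsorDescent
  (level_mem_iff level_data commutator_sup_lcs_top_le)

namespace Summit.SmoothPoincare4.SmoothPoincare4.Theorems.ShadowApproximation.NilpotentGenusClass

variable {G : Type*} [Group G]

/-- An automorphism maps each term of the lower central series onto itself. [folklore] -/
theorem map_lcs_eq_self (y : G ≃* G) (n : ℕ) :
    ((⊤ : Subgroup G).lowerCentralSeries n).map y.toMonoidHom = (⊤ : Subgroup G).lowerCentralSeries n := by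
  rw [Subgroup.map_lowerCentralSeries, ← MonoidHom.range_eq_map, MonoidHom.range_eq_top.2 y.surjective]

/-- An automorphism congruent to the identity modulo `γ` (`y s · s⁻¹ ∈ γ`, `γ = γ_{n+1}`) does not move
`P · γ`. [folklore] -/
theorem map_sup_lcs_eq_of_johnson (P : Subgroup G) (n : ℕ) (y : G ≃* G)
    (hy : ∀ s, y s * s⁻¹ ∈ (⊤ : Subgroup G).lowerCentralSeries n) :
    P.map y.toMonoidHom ⊔ (⊤ : Subgroup G).lowerCentralSeries n = P ⊔ (⊤ : Subgroup G).lowerCentralSeries n := by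
  apply le_antisymm
  · refine sup_le ?_ le_sup_right
    rintro _ ⟨p, hp, rfl⟩
    have e : y.toMonoidHom p = (y p * p⁻¹) * p := by simp
    rw [e, sup_comm]
    exact mul_mem_sup (hy p) hp
  · refine sup_le ?_ le_sup_right
    intro p hp
    have e : p = (y p * p⁻¹)⁻¹ * y.toMonoidHom p := by simp
    rw [e, sup_comm]
    exact mul_mem_sup (inv_mem (hy p)) (mem_map_of_mem _ hp)

/-- **The layer step from realised data.** `P = ⟪S⟫`, `Q` normal without hidden depth with
`Q γ_{c+2} = P γ_{c+2}`, lifts `u x ∈ γ_{c+2}` with `u x · x ∈ Q` (`x ∈ S`); if an automorphism `y` with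
`y s · s⁻¹ ∈ γ_{c+2}` (all `s`) has `y x · x⁻¹ · (u x)⁻¹ ∈ [P,G] γ_{c+3}` for every `x ∈ S`, then
`y(P γ_{c+3}) = Q γ_{c+3}` (Mathlib numbering: `γ_{k+1} = (⊤).lowerCentralSeries k`). [folklore] -/
theorem map_sup_lcs_eq_of_data (c : ℕ) (S : Set G) (Q : Subgroup G) [Q.Normal]
    (hQ : Q ⊓ (⊤ : Subgroup G).lowerCentralSeries 1 ≤ ⁅Q, (⊤ : Subgroup G)⁆)
    (hlev : Q ⊔ (⊤ : Subgroup G).lowerCentralSeries (c + 1) =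
      normalClosure S ⊔ (⊤ : Subgroup G).lowerCentralSeries (c + 1))
    (y : G ≃* G) (hy : ∀ s, y s * s⁻¹ ∈ (⊤ : Subgroup G).lowerCentralSeries (c + 1))
    (u : G → G) (hu : ∀ x ∈ S, u x ∈ (⊤ : Subgroup G).lowerCentralSeries (c + 1))
    (hux : ∀ x ∈ S, u x * x ∈ Q)
    (hdata : ∀ x ∈ S, y x * x⁻¹ * (u x)⁻¹ ∈
      ⁅normalClosure S, (⊤ : Subgroup G)⁆ ⊔ (⊤ : Subgroup G).lowerCentralSeries (c + 2)) :
    (normalClosure S ⊔ (⊤ : Subgroup G).lowerCentralSeries (c + 2)).map y.toMonoidHom =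
      Q ⊔ (⊤ : Subgroup G).lowerCentralSeries (c + 2) := by
  set P : Subgroup G := normalClosure S with hP
  haveI hPy : (P.map y.toMonoidHom).Normal := Subgroup.Normal.map inferInstance _ y.surjective
  rw [Subgroup.map_sup, map_lcs_eq_self]
  apply le_antisymm
  · -- `y(P) ≤ Q γ_{c+3}`: the images of the cut letters lie there by the membership criterion
    refine sup_le ?_ le_sup_right
    rw [hP, Subgroup.map_normalClosure _ _ y.surjective]
    refine normalClosure_le_normal ?_
    rintro _ ⟨x, hx, rfl⟩
    exact (level_mem_iff c Q P hQ hlev (hux x hx) (hy x) (hu x hx)).2 (hdata x hx)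
  · -- `Q ≤ y(P) γ_{c+3}`: `Q γ_{c+3}` is the normal closure of the lifts `u x · x`, up to `γ_{c+3}`
    refine sup_le ?_ le_sup_right
    set R : Subgroup G := normalClosure ((fun x => u x * x) '' S) with hR
    have hRQ : R ≤ Q := normalClosure_le_normal (by rintro _ ⟨x, hx, rfl⟩; exact hux x hx)
    have hPR : P ≤ R ⊔ (⊤ : Subgroup G).lowerCentralSeries (c + 1) := by
      refine normalClosure_le_normal fun x hx => ?_
      have e : x = (u x)⁻¹ * (u x * x) := by group
      rw [SetLike.mem_coe, e, sup_comm]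
      exact mul_mem_sup (inv_mem (hu x hx)) (subset_normalClosure ⟨x, hx, rfl⟩)
    have hQR : Q ≤ R ⊔ (⊤ : Subgroup G).lowerCentralSeries (c + 1) :=
      (le_sup_left.trans hlev.le).trans (sup_le hPR le_sup_right)
    have hQ3 : Q ⊔ (⊤ : Subgroup G).lowerCentralSeries (c + 2) =
        R ⊔ (⊤ : Subgroup G).lowerCentralSeries (c + 2) := level_data c Q R hQ hRQ hQR
    -- `[P,G] γ_{c+3} ≤ y(P) γ_{c+3}` because `y(P) γ_{c+2} = P γ_{c+2}`
    have hcomm : ⁅P, (⊤ : Subgroup G)⁆ ⊔ (⊤ : Subgroup G).lowerCentralSeries (c + 2) ≤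
        P.map y.toMonoidHom ⊔ (⊤ : Subgroup G).lowerCentralSeries (c + 2) := by
      refine sup_le ?_ le_sup_right
      have h1 : ⁅P, (⊤ : Subgroup G)⁆ ≤
          ⁅P.map y.toMonoidHom ⊔ (⊤ : Subgroup G).lowerCentralSeries (c + 1), (⊤ : Subgroup G)⁆ :=
        commutator_mono (by rw [map_sup_lcs_eq_of_johnson P (c + 1) y hy]; exact le_sup_left) le_rfl
      exact h1.trans ((commutator_sup_lcs_top_le _ (c + 1)).trans
        (sup_le_sup_right (commutator_le_left _ _) _))
    have hR3 : R ≤ P.map y.toMonoidHom ⊔ (⊤ : Subgroup G).lowerCentralSeries (c + 2) := by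
      refine normalClosure_le_normal ?_
      rintro _ ⟨x, hx, rfl⟩
      have e : u x * x = (y x * x⁻¹ * (u x)⁻¹)⁻¹ * y.toMonoidHom x := by simp; group
      change u x * x ∈ _
      rw [e]
      refine mul_mem (hcomm (inv_mem (hdata x hx))) (mem_sup_left (mem_map_of_mem _ ?_))
      exact subset_normalClosure hx
    calc Q ≤ Q ⊔ (⊤ : Subgroup G).lowerCentralSeries (c + 2) := le_sup_left
      _ = R ⊔ (⊤ : Subgroup G).lowerCentralSeries (c + 2) := hQ3
      _ ≤ P.map y.toMonoidHom ⊔ (⊤ : Subgroup G).lowerCentralSeries (c + 2) := sup_le hR3 le_sup_right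

end Summit.SmoothPoincare4.SmoothPoincare4.Theorems.ShadowApproximation.NilpotentGenusClass

namespace Summit.SmoothPoincare4.SmoothPoincare4.Theorems.ShadowApproximation.NilpotentGenusClass

/-- **Registered helper `helper_layerOfData`** (sub-goal of stub `stub_nilpotentLayerStep`, item
stmt-SmoothPoincare4-14595): `map_sup_lcs_eq_of_data` specialised to the surface groups, closed `∀`-form. [folklore] -/
theorem helper_layerOfData : ∀ (g c : ℕ) (S : Set (Literature.Topology.FourManifolds.SurfaceGroup g)) (Q : Subgroup (Literature.Topology.FourManifolds.SurfaceGroup g)) [Q.Normal], Q ⊓ (⊤ : Subgroup (Literature.Topology.FourManifolds.SurfaceGroup g)).lowerCentralSeries 1 ≤ ⁅Q, (⊤ : Subgroup (Literature.Topology.FourManifolds.SurfaceGroup g))⁆ → Q ⊔ (⊤ : Subgroup (Literature.Topology.FourManifolds.SurfaceGroup g)).lowerCentralSeries (c + 1) = Subgroup.normalClosure S ⊔ (⊤ : Subgroup (Literature.Topology.FourManifolds.SurfaceGroup g)).lowerCentralSeries (c + 1) → ∀ (y : Literature.Topology.FourManifolds.SurfaceGroup g ≃* Literature.Topology.FourManifolds.SurfaceGroup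 g), (∀ s, y s * s⁻¹ ∈ (⊤ : Subgroup (Literature.Topology.FourManifolds.SurfaceGroup g)).lowerCentralSeries (c + 1)) → ∀ (u : Literature.Topology.FourManifolds.SurfaceGroup g → Literature.Topology.FourManifolds.SurfaceGroup g), (∀ x ∈ S, u x ∈ (⊤ : Subgroup (Literature.Topology.FourManifolds.SurfaceGroup g)).lowerCentralSeries (c + 1)) → (∀ x ∈ S, u x * x ∈ Q) → (∀ x ∈ S, y x * x⁻¹ * (u x)⁻¹ ∈ ⁅Subgroup.normalClosure S, (⊤ : Subgroup (Literature.Topology.FourManifolds.SurfaceGroup g))⁆ ⊔ (⊤ : Subgroup (Literature.Topology.FourManifolds.SurfaceGroup g)).lowerCentralSeries (c + 2)) → (Subgroup.normalClosure S ⊔ (⊤ : Subgroup (Literature.Topology.FourManifolds.SurfaceGroup g)).lowerCentralSeries (c + 2)).map y.toMonoidHom = Q ⊔ (⊤ : Subgroup (Literature.Topology.FourManifolds.SurfaceGroup g)).lowerCentralSeries (c + 2) :=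
  fun _ c S Q _ hQ hlev y hy u hu hux hdata => map_sup_lcs_eq_of_data c S Q hQ hlev y hy u hu hux hdata

end Summit.SmoothPoincare4.SmoothPoincare4.Theorems.ShadowApproximation.NilpotentGenusClass
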